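import Summits.Ventures.PercRepro2.CaseOneA2Edge

/-!
# An `a₂a₃`-edge can be deleted for `(ii)` and for `(i)`: the theorems (blind cell PercRepro2, p1 g30)

With the identities `iiExpr_a2_edge` / `iExpr_a2_edge` and the sign facts `a2_bThreshold_nonneg` /
`a2_b1Threshold_nonpos` of `CaseOneA2Edge.lean` and the odds lemma `odds_pd`: **`zSplitII_of_a2_edge`**
(`ZSplitII p[e₂ ↦ 0] ⟹ ZSplitII p`) and **`zSplitI_of_a2_edge`** for every edge `e₂ = {a₂, a₃}`, and
by iteration **`zSplitII_of_a2Free`** / **`zSplitI_of_a2Free`**: `(ii)` and `(i)` at the PD pair hold for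
`p` as soon as they hold for every admissible weight vector with every `a₂a₃`-edge null — for these two
forms the statement vertex may be assumed to have no `a₂`-edges. Own code; standard axioms.
-/

namespace Summit.Ventures.PercRepro2

namespace CaseOne

section Theorems
variable {V : Type*} {E : Type*} [Fintype E] [DecidableEq E] [Fintype V] [DecidableEq V]
  {R : Type*} [Field R] [LinearOrder R] [IsStrictOrderedRing R]
variable {ends : E → Sym2 V} {a₁ a₂ a₃ : V} {e₂ : E}

/-- **The `(ii)`-side mixed term is nonnegative** when `(ii)` holds for `G − e₂`: `X₀ · M = X₁ · iiExpr p₀ + (X₀ Y₁ − X₁ Y₀)(D₀ₒ P₁ − D₀ P₃)`. -/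
theorem a2MixII_nonneg (p : E → R) (hp : IsProbVec p) (he : ends e₂ = s(a₂, a₃)) (o b : V)
    (h : ZSplitII (Function.update p e₂ 0) ends o a₁ a₂ a₃ b) :
    0 ≤ Dpd (Function.update p e₂ 0) ends a₁ a₂ a₃ *
    (prob (Function.update p e₂ 1) (connEvent ends a₁ a₂)ᶜ *
    prob (Function.update p e₂ 0) (connEvent ends a₂ b ∩ connEvent ends a₁ a₃ ∩
    connEvent ends a₂ o ∩ (connEvent ends a₁ a₂)ᶜ) -
    prob (Function.update p e₂ 1) (connEvent ends a₂ b ∩ (connEvent ends a₁ a₂)ᶜ) *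
    prob (Function.update p e₂ 0) (connEvent ends a₁ a₃ ∩ connEvent ends a₂ o ∩
    (connEvent ends a₁ a₂)ᶜ)) -
    Dpdo (Function.update p e₂ 0) ends o a₁ a₂ a₃ *
    (prob (Function.update p e₂ 1) (connEvent ends a₁ a₂)ᶜ *
    prob (Function.update p e₂ 0) (connEvent ends a₂ b ∩ connEvent ends a₁ a₃ ∩
    (connEvent ends a₁ a₂)ᶜ) -
    prob (Function.update p e₂ 1) (connEvent ends a₂ b ∩ (connEvent ends a₁ a₂)ᶜ) *
    prob (Function.update p e₂ 0) (connEvent ends a₁ a₃ ∩ (connEvent ends a₁ a₂)ᶜ)) := by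
  unfold ZSplitII at h
  set p₀ := Function.update p e₂ 0 with hp₀
  have hp0 : IsProbVec p₀ := hp.update e₂ le_rfl zero_le_one
  set mix := Dpd (Function.update p e₂ 0) ends a₁ a₂ a₃ *
    (prob (Function.update p e₂ 1) (connEvent ends a₁ a₂)ᶜ *
    prob (Function.update p e₂ 0) (connEvent ends a₂ b ∩ connEvent ends a₁ a₃ ∩
    connEvent ends a₂ o ∩ (connEvent ends a₁ a₂)ᶜ) -
    prob (Function.update p e₂ 1) (connEvent ends a₂ b ∩ (connEvent ends a₁ a₂)ᶜ) *
    prob (Function.update p e₂ 0) (connEvent ends a₁ a₃ ∩ connEvent ends a₂ o ∩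
    (connEvent ends a₁ a₂)ᶜ)) -
    Dpdo (Function.update p e₂ 0) ends o a₁ a₂ a₃ *
    (prob (Function.update p e₂ 1) (connEvent ends a₁ a₂)ᶜ *
    prob (Function.update p e₂ 0) (connEvent ends a₂ b ∩ connEvent ends a₁ a₃ ∩
    (connEvent ends a₁ a₂)ᶜ) -
    prob (Function.update p e₂ 1) (connEvent ends a₂ b ∩ (connEvent ends a₁ a₂)ᶜ) *
    prob (Function.update p e₂ 0) (connEvent ends a₁ a₃ ∩ (connEvent ends a₁ a₂)ᶜ)) with hmixdef
  have hsign := a2_bThreshold_nonneg (a₁ := a₁) p hp he b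
  have hodds := odds_pd p₀ hp0 ends o a₁ a₂ a₃
  have hX1 : 0 ≤ prob (Function.update p e₂ 1) (connEvent ends a₁ a₂)ᶜ :=
    prob_nonneg (hp.update e₂ zero_le_one le_rfl) _
  have hX0 : 0 ≤ prob p₀ (connEvent ends a₁ a₂)ᶜ := prob_nonneg hp0 _
  -- the identity `X₀ · mix = X₁ · iiExpr p₀ + (X₀ Y₁ − X₁ Y₀)(D₀ₒ P₁ − D₀ P₃)`
  have key : prob p₀ (connEvent ends a₁ a₂)ᶜ * mix =
      prob (Function.update p e₂ 1) (connEvent ends a₁ a₂)ᶜ * iiExpr p₀ ends o a₁ a₂ a₃ b +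
        (prob p₀ (connEvent ends a₁ a₂)ᶜ *
            prob (Function.update p e₂ 1) (connEvent ends a₂ b ∩ (connEvent ends a₁ a₂)ᶜ) -
          prob (Function.update p e₂ 1) (connEvent ends a₁ a₂)ᶜ *
            prob p₀ (connEvent ends a₂ b ∩ (connEvent ends a₁ a₂)ᶜ)) *
        (Dpdo p₀ ends o a₁ a₂ a₃ * prob p₀ (connEvent ends a₁ a₃ ∩ (connEvent ends a₁ a₂)ᶜ) -
          Dpd p₀ ends a₁ a₂ a₃ *
            prob p₀ (connEvent ends a₁ a₃ ∩ connEvent ends a₂ o ∩ (connEvent ends a₁ a₂)ᶜ)) := by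
    rw [iiExpr_eq_iiExprT, iiExprT_eq, hmixdef]
    ring
  rcases eq_or_lt_of_le hX0 with hX0' | hX0'
  · -- `P₀(Q) = 0`: every `Q`-mass of `G − e₂` vanishes and the mixed term is `0`
    have hz : ∀ Y : Set (Config E), Y ⊆ (connEvent ends a₁ a₂)ᶜ → prob p₀ Y = 0 := fun Y hY =>
      le_antisymm (by rw [hX0']; exact prob_mono hp0 hY) (prob_nonneg hp0 Y)
    rw [hmixdef, hz _ (fun _ h => h.2), hz _ (fun _ h => h.2), hz _ (fun _ h => h.2),
      hz _ (fun _ h => h.2)]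
    simp
  · have hprod := mul_nonneg hsign (sub_nonneg.mpr hodds)
    have hrhs := add_nonneg (mul_nonneg hX1 h) hprod
    rw [← key] at hrhs
    exact nonneg_of_mul_nonneg_right hrhs hX0'

/-- **`(ii)` lifts along an `a₂a₃`-edge**: `ZSplitII p[e₂ ↦ 0] ⟹ ZSplitII p`. -/
theorem zSplitII_of_a2_edge (p : E → R) (hp : IsProbVec p) (he : ends e₂ = s(a₂, a₃)) (o b : V)
    (h : ZSplitII (Function.update p e₂ 0) ends o a₁ a₂ a₃ b) : ZSplitII p ends o a₁ a₂ a₃ b := by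
  unfold ZSplitII at h ⊢
  rw [iiExpr_a2_edge p he o b]
  set p₀ := Function.update p e₂ 0 with hp₀
  have hp0 : IsProbVec p₀ := hp.update e₂ le_rfl zero_le_one
  have hr0 : 0 ≤ p e₂ := hp.nonneg e₂
  have hr1 : 0 ≤ 1 - p e₂ := by linarith [hp.le_one e₂]
  have hmix := a2MixII_nonneg p hp he o b h
  exact mul_nonneg (pow_nonneg hr1 2) (add_nonneg (mul_nonneg hr1 h) (mul_nonneg hr0 hmix))

/-- **The `(i)`-side mixed term is nonnegative** when `(i)` holds for `G − e₂`. -/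
theorem a2MixI_nonneg (p : E → R) (hp : IsProbVec p) (he : ends e₂ = s(a₂, a₃)) (o b : V)
    (h : ZSplitI (Function.update p e₂ 0) ends o a₁ a₂ a₃ b) :
    0 ≤ -(Dpd (Function.update p e₂ 0) ends a₁ a₂ a₃ *
    (prob (Function.update p e₂ 1) (connEvent ends a₁ a₂)ᶜ *
    prob (Function.update p e₂ 0) (connEvent ends a₁ b ∩ connEvent ends a₁ a₃ ∩
    connEvent ends a₂ o ∩ (connEvent ends a₁ a₂)ᶜ) -
    prob (Function.update p e₂ 1) (connEvent ends a₁ b ∩ (connEvent ends a₁ a₂)ᶜ) *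
    prob (Function.update p e₂ 0) (connEvent ends a₁ a₃ ∩ connEvent ends a₂ o ∩
    (connEvent ends a₁ a₂)ᶜ))) +
    Dpdo (Function.update p e₂ 0) ends o a₁ a₂ a₃ *
    (prob (Function.update p e₂ 1) (connEvent ends a₁ a₂)ᶜ *
    prob (Function.update p e₂ 0) (connEvent ends a₁ b ∩ connEvent ends a₁ a₃ ∩
    (connEvent ends a₁ a₂)ᶜ) -
    prob (Function.update p e₂ 1) (connEvent ends a₁ b ∩ (connEvent ends a₁ a₂)ᶜ) *
    prob (Function.update p e₂ 0) (connEvent ends a₁ a₃ ∩ (connEvent ends a₁ a₂)ᶜ)) := by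
  unfold ZSplitI at h
  set p₀ := Function.update p e₂ 0 with hp₀
  have hp0 : IsProbVec p₀ := hp.update e₂ le_rfl zero_le_one
  set mix := -(Dpd (Function.update p e₂ 0) ends a₁ a₂ a₃ *
    (prob (Function.update p e₂ 1) (connEvent ends a₁ a₂)ᶜ *
    prob (Function.update p e₂ 0) (connEvent ends a₁ b ∩ connEvent ends a₁ a₃ ∩
    connEvent ends a₂ o ∩ (connEvent ends a₁ a₂)ᶜ) -
    prob (Function.update p e₂ 1) (connEvent ends a₁ b ∩ (connEvent ends a₁ a₂)ᶜ) *
    prob (Function.update p e₂ 0) (connEvent ends a₁ a₃ ∩ connEvent ends a₂ o ∩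
    (connEvent ends a₁ a₂)ᶜ))) +
    Dpdo (Function.update p e₂ 0) ends o a₁ a₂ a₃ *
    (prob (Function.update p e₂ 1) (connEvent ends a₁ a₂)ᶜ *
    prob (Function.update p e₂ 0) (connEvent ends a₁ b ∩ connEvent ends a₁ a₃ ∩
    (connEvent ends a₁ a₂)ᶜ) -
    prob (Function.update p e₂ 1) (connEvent ends a₁ b ∩ (connEvent ends a₁ a₂)ᶜ) *
    prob (Function.update p e₂ 0) (connEvent ends a₁ a₃ ∩ (connEvent ends a₁ a₂)ᶜ)) with hmixdef
  have hsign := a2_b1Threshold_nonpos (a₁ := a₁) p hp he b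
  have hodds := odds_pd p₀ hp0 ends o a₁ a₂ a₃
  have hX1 : 0 ≤ prob (Function.update p e₂ 1) (connEvent ends a₁ a₂)ᶜ :=
    prob_nonneg (hp.update e₂ zero_le_one le_rfl) _
  have hX0 : 0 ≤ prob p₀ (connEvent ends a₁ a₂)ᶜ := prob_nonneg hp0 _
  -- the identity `X₀ · mix = X₁ · iExpr p₀ + (X₀ R₁ − X₁ R₀)(D₀ P₃ − D₀ₒ P₁)`
  have key : prob p₀ (connEvent ends a₁ a₂)ᶜ * mix =
      prob (Function.update p e₂ 1) (connEvent ends a₁ a₂)ᶜ * iExpr p₀ ends o a₁ a₂ a₃ b +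
        (prob p₀ (connEvent ends a₁ a₂)ᶜ *
            prob (Function.update p e₂ 1) (connEvent ends a₁ b ∩ (connEvent ends a₁ a₂)ᶜ) -
          prob (Function.update p e₂ 1) (connEvent ends a₁ a₂)ᶜ *
            prob p₀ (connEvent ends a₁ b ∩ (connEvent ends a₁ a₂)ᶜ)) *
        (Dpd p₀ ends a₁ a₂ a₃ *
            prob p₀ (connEvent ends a₁ a₃ ∩ connEvent ends a₂ o ∩ (connEvent ends a₁ a₂)ᶜ) -
          Dpdo p₀ ends o a₁ a₂ a₃ * prob p₀ (connEvent ends a₁ a₃ ∩ (connEvent ends a₁ a₂)ᶜ)) := by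
    rw [iExpr_eq_iExprT, iExprT_eq, hmixdef]
    ring
  rcases eq_or_lt_of_le hX0 with hX0' | hX0'
  · have hz : ∀ Y : Set (Config E), Y ⊆ (connEvent ends a₁ a₂)ᶜ → prob p₀ Y = 0 := fun Y hY =>
      le_antisymm (by rw [hX0']; exact prob_mono hp0 hY) (prob_nonneg hp0 Y)
    rw [hmixdef, hz _ (fun _ h => h.2), hz _ (fun _ h => h.2), hz _ (fun _ h => h.2),
      hz _ (fun _ h => h.2)]
    simp
  · have hprod := mul_nonneg_of_nonpos_of_nonpos hsign (sub_nonpos.mpr hodds)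
    have hrhs := add_nonneg (mul_nonneg hX1 h) hprod
    rw [← key] at hrhs
    exact nonneg_of_mul_nonneg_right hrhs hX0'

/-- **`(i)` lifts along an `a₂a₃`-edge**: `ZSplitI p[e₂ ↦ 0] ⟹ ZSplitI p`. -/
theorem zSplitI_of_a2_edge (p : E → R) (hp : IsProbVec p) (he : ends e₂ = s(a₂, a₃)) (o b : V)
    (h : ZSplitI (Function.update p e₂ 0) ends o a₁ a₂ a₃ b) : ZSplitI p ends o a₁ a₂ a₃ b := by
  unfold ZSplitI at h ⊢
  rw [iExpr_a2_edge p he o b]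
  set p₀ := Function.update p e₂ 0 with hp₀
  have hp0 : IsProbVec p₀ := hp.update e₂ le_rfl zero_le_one
  have hr0 : 0 ≤ p e₂ := hp.nonneg e₂
  have hr1 : 0 ≤ 1 - p e₂ := by linarith [hp.le_one e₂]
  have hmix := a2MixI_nonneg p hp he o b h
  exact mul_nonneg (pow_nonneg hr1 2) (add_nonneg (mul_nonneg hr1 h) (mul_nonneg hr0 hmix))

end Theorems

/-! ## All `a₂a₃`-edges at once -/

section AllA2
variable {V : Type*} {E : Type*} [Fintype E] [DecidableEq E] [Fintype V] [DecidableEq V]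
  {R : Type*} [Field R] [LinearOrder R] [IsStrictOrderedRing R]
variable {ends : E → Sym2 V} {a₁ a₂ a₃ : V}

omit [Fintype V] [IsStrictOrderedRing R] in
/-- Pinning a live `a₂a₃`-edge removes it from the live `a₂a₃`-edge set. -/
lemma filter_liveA2_update (p : E → R) (ends : E → Sym2 V) (a₂ a₃ : V) (e : E) :
    (Finset.univ.filter fun e' => ends e' = s(a₂, a₃) ∧ Function.update p e 0 e' ≠ 0) =
      (Finset.univ.filter fun e' => ends e' = s(a₂, a₃) ∧ p e' ≠ 0).erase e := by
  ext e'
  simp only [Finset.mem_filter, Finset.mem_univ, true_and, Finset.mem_erase, ne_eq]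
  by_cases h : e' = e
  · subst h; simp
  · rw [Function.update_of_ne h]; tauto

/-- **`(ii)` is free of the `a₂`-edges at the statement vertex**: `ZSplitII p` holds as soon as it
holds for every admissible weight vector with every `a₂a₃`-edge null. -/
theorem zSplitII_of_a2Free (p : E → R) (hp : IsProbVec p) (o b : V)
    (base : ∀ p' : E → R, IsProbVec p' → (∀ e, ends e = s(a₂, a₃) → p' e = 0) →
      ZSplitII p' ends o a₁ a₂ a₃ b) :
    ZSplitII p ends o a₁ a₂ a₃ b := by
  generalize hn : (Finset.univ.filter fun e' => ends e' = s(a₂, a₃) ∧ p e' ≠ 0).card = n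
  induction n using Nat.strong_induction_on generalizing p with
  | _ n ih =>
    by_cases h0 : (Finset.univ.filter fun e' => ends e' = s(a₂, a₃) ∧ p e' ≠ 0) = ∅
    · refine base p hp fun e he => ?_
      by_contra hc
      have : e ∈ (Finset.univ.filter fun e' => ends e' = s(a₂, a₃) ∧ p e' ≠ 0) := by simp [he, hc]
      rw [h0] at this
      exact absurd this (Finset.notMem_empty e)
    · obtain ⟨e, he⟩ := Finset.nonempty_iff_ne_empty.mpr h0
      have he' : ends e = s(a₂, a₃) := by
        have := he
        simp only [Finset.mem_filter, Finset.mem_univ, true_and] at this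
        exact this.1
      have hlt : ((Finset.univ.filter fun e' => ends e' = s(a₂, a₃) ∧ p e' ≠ 0).erase e).card < n := by
        rw [← hn]; exact Finset.card_erase_lt_of_mem he
      have hp0 : IsProbVec (Function.update p e 0) := hp.update e le_rfl zero_le_one
      have hrec := ih _ hlt (Function.update p e 0) hp0 (by rw [filter_liveA2_update])
      exact zSplitII_of_a2_edge p hp he' o b hrec

/-- **`(i)` is free of the `a₂`-edges at the statement vertex.** -/
theorem zSplitI_of_a2Free (p : E → R) (hp : IsProbVec p) (o b : V)
    (base : ∀ p' : E → R, IsProbVec p' → (∀ e, ends e = s(a₂, a₃) → p' e = 0) →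
      ZSplitI p' ends o a₁ a₂ a₃ b) :
    ZSplitI p ends o a₁ a₂ a₃ b := by
  generalize hn : (Finset.univ.filter fun e' => ends e' = s(a₂, a₃) ∧ p e' ≠ 0).card = n
  induction n using Nat.strong_induction_on generalizing p with
  | _ n ih =>
    by_cases h0 : (Finset.univ.filter fun e' => ends e' = s(a₂, a₃) ∧ p e' ≠ 0) = ∅
    · refine base p hp fun e he => ?_
      by_contra hc
      have : e ∈ (Finset.univ.filter fun e' => ends e' = s(a₂, a₃) ∧ p e' ≠ 0) := by simp [he, hc]
      rw [h0] at this
      exact absurd this (Finset.notMem_empty e)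
    · obtain ⟨e, he⟩ := Finset.nonempty_iff_ne_empty.mpr h0
      have he' : ends e = s(a₂, a₃) := by
        have := he
        simp only [Finset.mem_filter, Finset.mem_univ, true_and] at this
        exact this.1
      have hlt : ((Finset.univ.filter fun e' => ends e' = s(a₂, a₃) ∧ p e' ≠ 0).erase e).card < n := by
        rw [← hn]; exact Finset.card_erase_lt_of_mem he
      have hp0 : IsProbVec (Function.update p e 0) := hp.update e le_rfl zero_le_one
      have hrec := ih _ hlt (Function.update p e 0) hp0 (by rw [filter_liveA2_update])
      exact zSplitI_of_a2_edge p hp he' o b hrec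

end AllA2

end CaseOne

end Summit.Ventures.PercRepro2
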